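import Summits.RiemannHypothesis.RiemannHypothesis.Theorems.PfPersistenceMarkovCoreResponse
import HarnessLib

/-!
# PF persistence (theory 1, edge law): THE MARKOV CORE OF A NON-NEGATIVE WEIGHT TABLE, XIII —
# the Feynman–Hellmann dial law: the core bottom is DIFFERENTIABLE in every weight, with derivative
# the response (the lag increment of the ground state)

Helper file (`--supports stmt-RiemannHypothesis-19953`); mechanism/rigidity campaign; no RH claims.
Thirteenth file of the chain `PfPersistenceMarkovCore*`.  File IX made `w ↦ coreBottom w a` monotone,
concave and `4`-Lipschitz in the table, file XI strictly monotone in each weight at `n ≥ 2`, file XII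
identified the supergradient (the response `coreResponse w a (log n) = D_{log n}(u_w)`) and proved it
continuous along tables.  Here the dial law becomes an exact FIRST-ORDER law — the Feynman–Hellmann
theorem of the core — with both textbook hypotheses DISCHARGED on the whole class: simplicity of the
level = uniqueness of the core ground state up to a phase (file IV), continuity of the eigenvector in
the parameter = stability (file X); no operator, no spectral gap, no rate:

* **`hasDerivWithinAt_coreBottom_of_dir`, `hasDerivAt_coreBottom_of_dir`** — along every direction
  `v` keeping the table non-negative on the index for `t ∈ [0, δ]` (resp. `[-δ, δ]`),
  `t ↦ coreBottom (w + t v) a` has (right) derivative `Σ_{index} v n · coreResponse w a (log n)` at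
  `t = 0` (squeeze of the difference quotient between the responses of `w + t v` and of `w`, file XII,
  and continuity of the response, file X).
* **`hasDerivWithinAt_coreBottom_update`, `hasDerivAt_coreBottom_update`,
  `hasDerivWithinAt_coreBottom_update_at`** — the PARTIAL DERIVATIVES: for `n₀ ∈ weilPrimeIndex a`
  the dial function `s ↦ coreBottom (update w n₀ s) a` is differentiable at every `s ≥ 0` within
  `[0, ∞)` (two-sidedly at `s > 0`) with derivative `coreResponse (update w n₀ s) a (log n₀)`, which
  is `> 0` for `n₀ ≥ 2`, `≤ 4`, antitone and continuous in `s` (file XII): along each prime dial the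
  bottom is `C¹`, strictly increasing and concave — for EVERY non-negative table at EVERY window.
  Holding for all members of the class, this distinguishes no table from another: structure, not an
  invariant.
* `continuousOn_coreResponse_update`, `coreBottom_update_C1` — the response along a dial is
  continuous on `[0, ∞)`; the `C¹` statement assembled.

## References

* H. Hellmann, *Einführung in die Quantenchemie* (1937) §54; R. P. Feynman, *Forces in molecules*,
  Phys. Rev. 56 (1939) 340–343 (`dE/dλ = ⟨ψ_λ, (∂H/∂λ) ψ_λ⟩` at a simple level).
* T. Kato, *Perturbation Theory for Linear Operators* (1966), II §6.4–6.5, VII §4.6.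
* R. T. Rockafellar, *Convex Analysis* (1970), Thm 25.1 (a concave function with a single
  supergradient at a point is differentiable there) — the shape of the argument.
* M. Reed, B. Simon, *Methods of Modern Mathematical Physics IV* (1978), §XIII.12.
-/

set_option linter.dupNamespace false

noncomputable section

open MeasureTheory Set Filter
open scoped Topology ENNReal NNReal ComplexConjugate

namespace Summit.RiemannHypothesis.RiemannHypothesis.Theorems.PfPersistence

open Literature.NumberTheory.LFunctions Literature.NumberTheory.LFunctions.ConnesVanSuijlekom
open Summit.RiemannHypothesis.RiemannHypothesis.Theorems.WeilGroundStateMarkovPart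

variable {a : ℝ} {w : ℕ → ℝ}

/-! ## §1 The Feynman–Hellmann law along a direction -/

section Direction

variable {v : ℕ → ℝ} {lo hi : ℝ}

/-- The table moved along the direction `v`: `(w + t v) n = w n + t · v n`. -/
private abbrev linePath (w v : ℕ → ℝ) (t : ℝ) : ℕ → ℝ := fun n ↦ w n + t * v n

/-- At `t = 0` the moved table is `w`. -/
private theorem linePath_zero (w v : ℕ → ℝ) : linePath w v 0 = w := by
  funext n
  simp [linePath]

/-- `tableDist a (w + t v) w = |t| Σ_{index} |v n|`. -/
private theorem tableDist_linePath (w v : ℕ → ℝ) (t : ℝ) :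
    tableDist a (linePath w v t) w = |t| * ∑ n ∈ weilPrimeIndex a, |v n| := by
  unfold tableDist
  rw [Finset.mul_sum]
  exact Finset.sum_congr rfl fun n _ ↦ by simp [linePath, abs_mul]

/-- The two supergradient inequalities along the line, in response form: for every `t` at which the
moved table is non-negative,
`t · Σ v n · R_{w+tv}(log n) ≤ coreBottom (w + t v) a − coreBottom w a ≤ t · Σ v n · R_w(log n)`. -/
private theorem line_bounds (hw : ∀ n ∈ weilPrimeIndex a, 0 ≤ w n) (ha : 0 < a) {t : ℝ}
    (ht : ∀ n ∈ weilPrimeIndex a, 0 ≤ w n + t * v n) :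
    t * ∑ n ∈ weilPrimeIndex a, v n * coreResponse (linePath w v t) a (Real.log n) ≤
        coreBottom (linePath w v t) a - coreBottom w a ∧
      coreBottom (linePath w v t) a - coreBottom w a ≤
        t * ∑ n ∈ weilPrimeIndex a, v n * coreResponse w a (Real.log n) := by
  have ht' : ∀ n ∈ weilPrimeIndex a, 0 ≤ linePath w v t n := ht
  obtain ⟨u, hu⟩ := exists_isCoreGround hw ha
  obtain ⟨ut, hut⟩ := exists_isCoreGround ht' ha
  have h1 := coreBottom_le_add_sum ht' hu      -- bottom of `w + tv` tested by `u`
  have h2 := coreBottom_le_add_sum hw hut      -- bottom of `w` tested by `u_t`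
  have e1 : ∑ n ∈ weilPrimeIndex a, (linePath w v t n - w n) * weilIncrement u (Real.log n) =
      t * ∑ n ∈ weilPrimeIndex a, v n * coreResponse w a (Real.log n) := by
    rw [Finset.mul_sum]
    exact Finset.sum_congr rfl fun n _ ↦ by
      rw [coreResponse_eq hw ha hu]; simp [linePath]; ring
  have e2 : ∑ n ∈ weilPrimeIndex a, (w n - linePath w v t n) * weilIncrement ut (Real.log n) =
      -(t * ∑ n ∈ weilPrimeIndex a, v n * coreResponse (linePath w v t) a (Real.log n)) := by
    rw [Finset.mul_sum, ← Finset.sum_neg_distrib]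
    exact Finset.sum_congr rfl fun n _ ↦ by
      rw [coreResponse_eq ht' ha hut]; simp [linePath]; ring
  rw [e1] at h1
  rw [e2] at h2
  constructor <;> linarith

/-- Continuity of the directional response at `t = 0` within a parameter interval `[lo, hi] ∋ 0` on
which the moved table stays non-negative. -/
private theorem tendsto_lineResponse (hw : ∀ n ∈ weilPrimeIndex a, 0 ≤ w n) (ha : 0 < a)
    (hlo : lo ≤ 0) (hhi : 0 ≤ hi)
    (hv : ∀ t ∈ Icc lo hi, ∀ n ∈ weilPrimeIndex a, 0 ≤ w n + t * v n) :
    Tendsto (fun t ↦ ∑ n ∈ weilPrimeIndex a, v n * coreResponse (linePath w v t) a (Real.log n))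
      (𝓝[Icc lo hi] 0) (𝓝 (∑ n ∈ weilPrimeIndex a, v n * coreResponse w a (Real.log n))) := by
  -- clamp the parameter to `[lo, hi]`
  set τ : ℝ → ℝ := fun t ↦ max lo (min t hi) with hτ
  have hτmem : ∀ t, τ t ∈ Icc lo hi := fun t ↦
    ⟨le_max_left _ _, max_le (hlo.trans hhi) (min_le_right _ _)⟩
  have hτid : ∀ t ∈ Icc lo hi, τ t = t := fun t ht ↦ by
    rw [hτ]
    simp only [min_eq_left ht.2, max_eq_right ht.1]
  have hτ0 : τ 0 = 0 := hτid 0 ⟨hlo, hhi⟩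
  have hτc : Continuous τ := continuous_const.max (continuous_id.min continuous_const)
  -- the clamped response is continuous at `0` along every sequence (file X)
  set F : ℝ → ℝ := fun t ↦
    ∑ n ∈ weilPrimeIndex a, v n * coreResponse (linePath w v t) a (Real.log n) with hF
  have hseq : Tendsto (F ∘ τ) (𝓝 0)
      (𝓝 (∑ n ∈ weilPrimeIndex a, v n * coreResponse w a (Real.log n))) := by
    rw [tendsto_iff_seq_tendsto]
    intro x hx
    have hy : Tendsto (fun k ↦ τ (x k)) atTop (𝓝 0) := by
      have h1 := (hτc.tendsto 0).comp hx
      rw [hτ0] at h1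
      exact h1
    have hwk : ∀ k, ∀ n ∈ weilPrimeIndex a, 0 ≤ linePath w v (τ (x k)) n := fun k ↦
      hv _ (hτmem _)
    have hd : Tendsto (fun k ↦ tableDist a (linePath w v (τ (x k))) w) atTop (𝓝 0) := by
      simp only [tableDist_linePath]
      simpa using (continuous_abs.tendsto 0 |>.comp hy).mul_const
        (∑ n ∈ weilPrimeIndex a, |v n|)
    have h := fun n (_ : n ∈ weilPrimeIndex a) ↦
      (tendsto_coreResponse_of_tables hw hwk ha hd (Real.log n)).const_mul (v n)
    simpa [hF, Function.comp_def] using tendsto_finsetSum (weilPrimeIndex a) h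
  -- and agrees with the response on `[lo, hi]`
  have hev : ∀ᶠ t in 𝓝[Icc lo hi] 0, (F ∘ τ) t = F t := by
    filter_upwards [self_mem_nhdsWithin] with t ht
    simp only [Function.comp_apply, hτid t ht]
  exact (hseq.mono_left nhdsWithin_le_nhds).congr' hev

/-- Right slopes: under non-negativity on `[lo, hi]` with `0 < hi`, the slope of
`t ↦ coreBottom (w + t v) a` at `0` tends to `Σ v n · R_w(log n)` from the right. -/
private theorem tendsto_slope_right (hw : ∀ n ∈ weilPrimeIndex a, 0 ≤ w n) (ha : 0 < a)
    (hlo : lo ≤ 0) (hhi : 0 < hi)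
    (hv : ∀ t ∈ Icc lo hi, ∀ n ∈ weilPrimeIndex a, 0 ≤ w n + t * v n) :
    Tendsto (slope (fun t ↦ coreBottom (linePath w v t) a) 0) (𝓝[>] 0)
      (𝓝 (∑ n ∈ weilPrimeIndex a, v n * coreResponse w a (Real.log n))) := by
  have hsub : Ioo 0 hi ⊆ Icc lo hi := fun t ht ↦ ⟨hlo.trans ht.1.le, ht.2.le⟩
  have hlow : Tendsto
      (fun t ↦ ∑ n ∈ weilPrimeIndex a, v n * coreResponse (linePath w v t) a (Real.log n))
      (𝓝[>] 0) (𝓝 (∑ n ∈ weilPrimeIndex a, v n * coreResponse w a (Real.log n))) := by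
    have h := (tendsto_lineResponse hw ha hlo hhi.le hv).mono_left (nhdsWithin_mono 0 hsub)
    rwa [nhdsWithin_Ioo_eq_nhdsGT hhi] at h
  refine tendsto_of_tendsto_of_tendsto_of_le_of_le' hlow tendsto_const_nhds ?_ ?_
  · filter_upwards [Ioo_mem_nhdsGT hhi] with t ht
    have hb := (line_bounds hw ha (hv t (hsub ht))).1
    rw [slope_def_field, linePath_zero, sub_zero]
    exact (le_div_iff₀ ht.1).2 (by linarith)
  · filter_upwards [Ioo_mem_nhdsGT hhi] with t ht
    have hb := (line_bounds hw ha (hv t (hsub ht))).2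
    rw [slope_def_field, linePath_zero, sub_zero]
    exact (div_le_iff₀ ht.1).2 (by linarith)

/-- Left slopes: under non-negativity on `[lo, hi]` with `lo < 0`, the slope at `0` tends to
`Σ v n · R_w(log n)` from the left. -/
private theorem tendsto_slope_left (hw : ∀ n ∈ weilPrimeIndex a, 0 ≤ w n) (ha : 0 < a)
    (hlo : lo < 0) (hhi : 0 ≤ hi)
    (hv : ∀ t ∈ Icc lo hi, ∀ n ∈ weilPrimeIndex a, 0 ≤ w n + t * v n) :
    Tendsto (slope (fun t ↦ coreBottom (linePath w v t) a) 0) (𝓝[<] 0)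
      (𝓝 (∑ n ∈ weilPrimeIndex a, v n * coreResponse w a (Real.log n))) := by
  have hsub : Ioo lo 0 ⊆ Icc lo hi := fun t ht ↦ ⟨ht.1.le, ht.2.le.trans hhi⟩
  have hup : Tendsto
      (fun t ↦ ∑ n ∈ weilPrimeIndex a, v n * coreResponse (linePath w v t) a (Real.log n))
      (𝓝[<] 0) (𝓝 (∑ n ∈ weilPrimeIndex a, v n * coreResponse w a (Real.log n))) := by
    have h := (tendsto_lineResponse hw ha hlo.le hhi hv).mono_left (nhdsWithin_mono 0 hsub)
    rwa [nhdsWithin_Ioo_eq_nhdsLT hlo] at h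
  refine tendsto_of_tendsto_of_tendsto_of_le_of_le' tendsto_const_nhds hup ?_ ?_
  · filter_upwards [Ioo_mem_nhdsLT hlo] with t ht
    have hb := (line_bounds hw ha (hv t (hsub ht))).2
    rw [slope_def_field, linePath_zero, sub_zero]
    exact (le_div_iff_of_neg ht.2).2 (by linarith)
  · filter_upwards [Ioo_mem_nhdsLT hlo] with t ht
    have hb := (line_bounds hw ha (hv t (hsub ht))).1
    rw [slope_def_field, linePath_zero, sub_zero]
    exact (div_le_iff_of_neg ht.2).2 (by linarith)

/-- **FEYNMAN–HELLMANN FOR THE MARKOV CORE, one-sided.**  Let `w ≥ 0` on the prime index of the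
window `[-a, a]` (`a > 0`) and let `v` be a direction with `w + t v ≥ 0` on the index for
`t ∈ [0, δ]`, `δ > 0`.  Then `t ↦ coreBottom (w + t v) a` has the RIGHT DERIVATIVE
`Σ_{index} v n · coreResponse w a (log n) = Σ v n · D_{log n}(u_w)` at `t = 0`. [cite: Kato1966, II §6.5] -/
theorem hasDerivWithinAt_coreBottom_of_dir (hw : ∀ n ∈ weilPrimeIndex a, 0 ≤ w n) (ha : 0 < a)
    {δ : ℝ} (hδ : 0 < δ) (hv : ∀ t ∈ Icc 0 δ, ∀ n ∈ weilPrimeIndex a, 0 ≤ w n + t * v n) :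
    HasDerivWithinAt (fun t ↦ coreBottom (fun n ↦ w n + t * v n) a)
      (∑ n ∈ weilPrimeIndex a, v n * coreResponse w a (Real.log n)) (Ici 0) 0 := by
  refine HasDerivWithinAt.Ici_of_Ioi ?_
  rw [hasDerivWithinAt_iff_tendsto_slope' (Set.self_notMem_Ioi (a := (0 : ℝ)))]
  exact tendsto_slope_right hw ha le_rfl hδ hv

/-- The mirror statement: non-negativity on `[-δ, 0]` gives the LEFT derivative. [cite: Kato1966, II §6.5] -/
theorem hasDerivWithinAt_coreBottom_of_dir_left (hw : ∀ n ∈ weilPrimeIndex a, 0 ≤ w n)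
    (ha : 0 < a) {δ : ℝ} (hδ : 0 < δ)
    (hv : ∀ t ∈ Icc (-δ) 0, ∀ n ∈ weilPrimeIndex a, 0 ≤ w n + t * v n) :
    HasDerivWithinAt (fun t ↦ coreBottom (fun n ↦ w n + t * v n) a)
      (∑ n ∈ weilPrimeIndex a, v n * coreResponse w a (Real.log n)) (Iic 0) 0 := by
  refine HasDerivWithinAt.Iic_of_Iio ?_
  rw [hasDerivWithinAt_iff_tendsto_slope' (Set.self_notMem_Iio (a := (0 : ℝ)))]
  exact tendsto_slope_left hw ha (neg_lt_zero.2 hδ) le_rfl hv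

/-- **FEYNMAN–HELLMANN FOR THE MARKOV CORE, two-sided.**  If `w + t v ≥ 0` on the prime index for
`t ∈ [-δ, δ]`, then `t ↦ coreBottom (w + t v) a` is DIFFERENTIABLE at `t = 0` with derivative
`Σ_{index} v n · coreResponse w a (log n)`.  Hypotheses of the textbook statement and their discharge:
simplicity of the level = file IV (`IsCoreGround.unique`), continuity of the eigenvector in the
parameter = file X (`IsCoreGround.tendsto_of_tables`); no operator, no spectral gap. [cite: Kato1966, II §6.4–6.5] -/
theorem hasDerivAt_coreBottom_of_dir (hw : ∀ n ∈ weilPrimeIndex a, 0 ≤ w n) (ha : 0 < a)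
    {δ : ℝ} (hδ : 0 < δ) (hv : ∀ t ∈ Icc (-δ) δ, ∀ n ∈ weilPrimeIndex a, 0 ≤ w n + t * v n) :
    HasDerivAt (fun t ↦ coreBottom (fun n ↦ w n + t * v n) a)
      (∑ n ∈ weilPrimeIndex a, v n * coreResponse w a (Real.log n)) 0 := by
  rw [hasDerivAt_iff_tendsto_slope_left_right]
  exact ⟨tendsto_slope_left hw ha (neg_lt_zero.2 hδ) hδ.le hv,
    tendsto_slope_right hw ha (neg_nonpos.2 hδ.le) hδ hv⟩

/-- The derivative in ground-state form: `Σ v n · D_{log n}(u)` for any core ground state `u` of `w`. [cite: Kato1966, II §6.5] -/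
theorem hasDerivAt_coreBottom_of_dir' (hw : ∀ n ∈ weilPrimeIndex a, 0 ≤ w n) (ha : 0 < a)
    {δ : ℝ} (hδ : 0 < δ) (hv : ∀ t ∈ Icc (-δ) δ, ∀ n ∈ weilPrimeIndex a, 0 ≤ w n + t * v n)
    {u : ℝ → ℂ} (hu : IsCoreGround w a u) :
    HasDerivAt (fun t ↦ coreBottom (fun n ↦ w n + t * v n) a)
      (∑ n ∈ weilPrimeIndex a, v n * weilIncrement u (Real.log n)) 0 := by
  have h := hasDerivAt_coreBottom_of_dir hw ha hδ hv
  simpa only [coreResponse_eq hw ha hu] using h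

end Direction

/-! ## §2 The partial derivatives: one dial -/

/-- The indicator direction of the index point `n₀`. -/
private def dialDir (n₀ : ℕ) : ℕ → ℝ := fun n ↦ if n = n₀ then 1 else 0

/-- `update w n₀ s = w + (s − w n₀) · dialDir n₀`. -/
private theorem update_eq_linePath (w : ℕ → ℝ) (n₀ : ℕ) (s : ℝ) :
    Function.update w n₀ s = fun n ↦ w n + (s - w n₀) * dialDir n₀ n := by
  funext n
  rcases eq_or_ne n n₀ with rfl | hne
  · simp [dialDir]
  · simp [dialDir, hne]

/-- Sums against the indicator direction pick out the `n₀` term. -/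
private theorem sum_dialDir_mul (n₀ : ℕ) (hn₀ : n₀ ∈ weilPrimeIndex a) (R : ℕ → ℝ) :
    ∑ n ∈ weilPrimeIndex a, dialDir n₀ n * R n = R n₀ := by
  rw [Finset.sum_eq_single_of_mem n₀ hn₀ (fun n _ hne ↦ by simp [dialDir, hne])]
  simp [dialDir]

/-- The table moved along `dialDir n₀` by `t` is non-negative iff `0 ≤ w n₀ + t`. -/
private theorem dial_nonneg (hw : ∀ n ∈ weilPrimeIndex a, 0 ≤ w n) (n₀ : ℕ) {t : ℝ}
    (ht : 0 ≤ w n₀ + t) : ∀ n ∈ weilPrimeIndex a, 0 ≤ w n + t * dialDir n₀ n := by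
  intro n hn
  rcases eq_or_ne n n₀ with rfl | hne
  · simpa [dialDir] using ht
  · simpa [dialDir, hne] using hw n hn

/-- **THE PARTIAL DERIVATIVE OF THE CORE BOTTOM IN ONE WEIGHT (Feynman–Hellmann).**  For `w ≥ 0` on
the prime index of `[-a, a]` (`a > 0`) and `n₀ ∈ weilPrimeIndex a`, the dial function
`s ↦ coreBottom (update w n₀ s) a` has, at `s = w n₀` and within `[0, ∞)`, the derivative
`coreResponse w a (log n₀) = D_{log n₀}(u_w)`: `∂ coreBottom / ∂ w(n₀) = D_{log n₀}(Φ_w)`. [cite: Kato1966, II §6.4–6.5] -/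
theorem hasDerivWithinAt_coreBottom_update (hw : ∀ n ∈ weilPrimeIndex a, 0 ≤ w n) (ha : 0 < a)
    {n₀ : ℕ} (hn₀ : n₀ ∈ weilPrimeIndex a) :
    HasDerivWithinAt (fun s ↦ coreBottom (Function.update w n₀ s) a)
      (coreResponse w a (Real.log n₀)) (Ici 0) (w n₀) := by
  have h0 : 0 ≤ w n₀ := hw n₀ hn₀
  -- the dial function is the line function along `dialDir n₀`, translated by `w n₀`
  have hfun : (fun s ↦ coreBottom (Function.update w n₀ s) a) =
      fun s ↦ coreBottom (fun n ↦ w n + (s - w n₀) * dialDir n₀ n) a := by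
    funext s
    rw [update_eq_linePath]
  rw [hfun, ← sum_dialDir_mul n₀ hn₀ (fun n ↦ coreResponse w a (Real.log n))]
  rcases h0.lt_or_eq with hpos | hzero
  · -- `w n₀ > 0`: two-sided
    have hv : ∀ t ∈ Icc (-(w n₀)) (w n₀), ∀ n ∈ weilPrimeIndex a,
        0 ≤ w n + t * dialDir n₀ n := fun t ht ↦ dial_nonneg hw n₀ (by linarith [ht.1])
    have h := hasDerivAt_coreBottom_of_dir hw ha hpos hv
    have h' := HasDerivAt.comp_sub_const (w n₀) (w n₀) (by simpa only [sub_self] using h)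
    exact h'.hasDerivWithinAt
  · -- `w n₀ = 0`: one-sided
    have hv : ∀ t ∈ Icc (0 : ℝ) 1, ∀ n ∈ weilPrimeIndex a, 0 ≤ w n + t * dialDir n₀ n :=
      fun t ht ↦ dial_nonneg hw n₀ (by linarith [ht.1])
    have h := hasDerivWithinAt_coreBottom_of_dir hw ha one_pos hv
    rw [← hzero]
    simpa only [sub_zero] using h

/-- **Two-sided partial derivative at a positive weight**: if moreover `0 < w n₀`, the dial function
is differentiable at `w n₀` in the ordinary sense, with the same derivative. [cite: Kato1966, II §6.4–6.5] -/
theorem hasDerivAt_coreBottom_update (hw : ∀ n ∈ weilPrimeIndex a, 0 ≤ w n) (ha : 0 < a)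
    {n₀ : ℕ} (hn₀ : n₀ ∈ weilPrimeIndex a) (hpos : 0 < w n₀) :
    HasDerivAt (fun s ↦ coreBottom (Function.update w n₀ s) a)
      (coreResponse w a (Real.log n₀)) (w n₀) :=
  (hasDerivWithinAt_coreBottom_update hw ha hn₀).hasDerivAt (Ici_mem_nhds hpos)

/-- Ground-state form of the partial derivative: `∂ coreBottom/∂ w(n₀) = D_{log n₀}(u)` for every core
ground state `u` of `w`. [cite: Kato1966, II §6.4–6.5] -/
theorem hasDerivWithinAt_coreBottom_update' (hw : ∀ n ∈ weilPrimeIndex a, 0 ≤ w n) (ha : 0 < a)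
    {n₀ : ℕ} (hn₀ : n₀ ∈ weilPrimeIndex a) {u : ℝ → ℂ} (hu : IsCoreGround w a u) :
    HasDerivWithinAt (fun s ↦ coreBottom (Function.update w n₀ s) a)
      (weilIncrement u (Real.log n₀)) (Ici 0) (w n₀) := by
  rw [← coreResponse_eq hw ha hu]
  exact hasDerivWithinAt_coreBottom_update hw ha hn₀

/-- **The dial function is differentiable at EVERY point of `[0, ∞)`** with derivative the response of
the edited table: for `0 ≤ s`,
`d/ds coreBottom (update w n₀ s) a = coreResponse (update w n₀ s) a (log n₀)`. [cite: Kato1966, II §6.4–6.5] -/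
theorem hasDerivWithinAt_coreBottom_update_at (hw : ∀ n ∈ weilPrimeIndex a, 0 ≤ w n) (ha : 0 < a)
    {n₀ : ℕ} (hn₀ : n₀ ∈ weilPrimeIndex a) {s : ℝ} (hs : 0 ≤ s) :
    HasDerivWithinAt (fun s ↦ coreBottom (Function.update w n₀ s) a)
      (coreResponse (Function.update w n₀ s) a (Real.log n₀)) (Ici 0) s := by
  have hws : ∀ n ∈ weilPrimeIndex a, 0 ≤ Function.update w n₀ s n := update_nonneg hw n₀ hs
  have h := hasDerivWithinAt_coreBottom_update hws ha hn₀
  simp only [Function.update_idem, Function.update_self] at h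
  exact h

/-- **Sign and size of the partial derivative**: `0 < ∂ coreBottom/∂ w(n₀) ≤ 4` for `n₀ ≥ 2` in the
index — the STRICT dial law of file XI in differential form, with the universal bound `D ≤ 4`. [folklore] -/
theorem coreResponse_log_pos_le_four (hw : ∀ n ∈ weilPrimeIndex a, 0 ≤ w n) (ha : 0 < a) {n₀ : ℕ}
    (h2 : 2 ≤ n₀) :
    0 < coreResponse w a (Real.log n₀) ∧ coreResponse w a (Real.log n₀) ≤ 4 :=
  ⟨coreResponse_log_pos hw ha h2, coreResponse_le_four w a _⟩

/-! ## §3 The bottom is `C¹` along every dial -/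

/-- Two edits of the same weight are `|y − s|`-close in `tableDist` (`0` if `n₀` is off the index). -/
private theorem tableDist_update_le (w : ℕ → ℝ) (n₀ : ℕ) (y s : ℝ) :
    tableDist a (Function.update w n₀ y) (Function.update w n₀ s) ≤ |y - s| := by
  unfold tableDist
  by_cases hn₀ : n₀ ∈ weilPrimeIndex a
  · rw [Finset.sum_eq_single_of_mem n₀ hn₀ (fun n _ hne ↦ by
      rw [Function.update_of_ne hne, Function.update_of_ne hne, sub_self, abs_zero])]
    simp
  · refine le_of_eq_of_le (Finset.sum_eq_zero fun n hn ↦ ?_) (abs_nonneg _)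
    have hne : n ≠ n₀ := fun h ↦ hn₀ (h ▸ hn)
    rw [Function.update_of_ne hne, Function.update_of_ne hne, sub_self, abs_zero]

/-- **The response along a dial is continuous on `[0, ∞)`**: for every lag `t` and every `n₀`,
`s ↦ coreResponse (update w n₀ s) a t` is continuous on `Ici 0` (file X along the dial).  With
`hasDerivWithinAt_coreBottom_update_at`: the core bottom is `C¹` along every prime dial, for every
non-negative table at every window. [folklore] -/
theorem continuousOn_coreResponse_update (hw : ∀ n ∈ weilPrimeIndex a, 0 ≤ w n) (ha : 0 < a)
    (n₀ : ℕ) (t : ℝ) :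
    ContinuousOn (fun s ↦ coreResponse (Function.update w n₀ s) a t) (Ici 0) := by
  intro s hs
  have hs0 : (0 : ℝ) ≤ s := hs
  rw [ContinuousWithinAt, tendsto_iff_seq_tendsto]
  intro x hx
  have hx0 : Tendsto x atTop (𝓝 s) := tendsto_nhds_of_tendsto_nhdsWithin hx
  have hxev : ∀ᶠ k in atTop, x k ∈ Ici (0 : ℝ) := hx.eventually eventually_mem_nhdsWithin
  -- clamp the sequence to `[0, ∞)` so that every edited table is non-negative
  have hclamp : Tendsto (fun k ↦ max (x k) 0) atTop (𝓝 s) := by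
    have h := hx0.max (tendsto_const_nhds (x := (0 : ℝ)))
    rwa [max_eq_left hs0] at h
  have hws : ∀ n ∈ weilPrimeIndex a, 0 ≤ Function.update w n₀ s n := update_nonneg hw n₀ hs0
  have hwk : ∀ k, ∀ n ∈ weilPrimeIndex a, 0 ≤ Function.update w n₀ (max (x k) 0) n :=
    fun k ↦ update_nonneg hw n₀ (le_max_right _ _)
  have hd : Tendsto (fun k ↦ tableDist a (Function.update w n₀ (max (x k) 0))
      (Function.update w n₀ s)) atTop (𝓝 0) := by
    refine squeeze_zero (fun k ↦ tableDist_nonneg _ _ _) (fun k ↦ tableDist_update_le w n₀ _ s) ?_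
    have h := (hclamp.sub_const s).abs
    rwa [sub_self, abs_zero] at h
  have hlim := tendsto_coreResponse_of_tables hws hwk ha hd t
  refine hlim.congr' ?_
  filter_upwards [hxev] with k hk
  simp only [Function.comp_apply, max_eq_left (show (0 : ℝ) ≤ x k from hk)]

/-- **`C¹` ALONG EVERY PRIME DIAL, assembled**: on `[0, ∞)` the dial function
`s ↦ coreBottom (update w n₀ s) a` has at every point the derivative
`coreResponse (update w n₀ s) a (log n₀)` within `[0, ∞)`, and this derivative is continuous on
`[0, ∞)`. [cite: Kato1966, II §6.4–6.5] -/
theorem coreBottom_update_C1 (hw : ∀ n ∈ weilPrimeIndex a, 0 ≤ w n) (ha : 0 < a) {n₀ : ℕ}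
    (hn₀ : n₀ ∈ weilPrimeIndex a) :
    (∀ s ∈ Ici (0 : ℝ), HasDerivWithinAt (fun s ↦ coreBottom (Function.update w n₀ s) a)
        (coreResponse (Function.update w n₀ s) a (Real.log n₀)) (Ici 0) s) ∧
      ContinuousOn (fun s ↦ coreResponse (Function.update w n₀ s) a (Real.log n₀)) (Ici 0) :=
  ⟨fun _ hs ↦ hasDerivWithinAt_coreBottom_update_at hw ha hn₀ hs,
    continuousOn_coreResponse_update hw ha n₀ _⟩


end Summit.RiemannHypothesis.RiemannHypothesis.Theorems.PfPersistence

end
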